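import Summits.QuantumFields.BalabanUV.Beta.EriceRemainderEnclosureHistoryAutonomyComparisonTowerSlack

/-!
# EriceRemainderEnclosureHistoryAutonomyComparisonTowerSlackEnd — (E64d) ENDs of (E64c): the FINSET FORM — a finite set of ages `A ⊆ [1,K[` with `30·k ≤ k′`
# for `k < k′` in `A`, ANY cardinality, ANY sizes, Markov rider, compares at any size — and THREE AGES WITH CONSECUTIVE RATIOS `≥ 30` ((E63c): `165`;
# (E62b): `260` without rider)

Cell `pub-balaban`, β-function sub-cell, BINDER row D4 «RemainderConst leaves for Bałaban's split» (`HOME/BINDER-OWNERS.md`; owner lineage `b2b-balaban-beta-an4`;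
this file by co-owner #2 lineage `b2b-balaban-beta-d4-p2`, generation 57), β-FLOW TEAM duty (1), FREEZE (0) honoured (def-free; (E64c)'s
`le_of_isotone_excess_tower_slack` and Mathlib's `Finset.orderEmbOfFin` BY NAME; nothing restated).

HONEST FRAMING (page 1, verbatim and binding).  *"Discharging BetaPertH makes Bałaban's UV stability UNCONDITIONAL — a real constructive-QFT result; it is
NOT the continuum limit and NOT the Clay problem."*  THIS FILE DISCHARGES NOTHING OF THE KIND.  Elementary real analysis about ABSTRACT affine functionals on a
box ]0,γ]^ℕ with displayed supports and signs — hypotheses of a census, not facts; the form, signs, ages and moments of Bałaban's (1.22) limit functional are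
NOT PRINTED ([I] p. 298; GAPS G-t4-U2-1∕-2) and NOT asserted.  Row D4 class UNCHANGED (critical-path width 0; instance 0∕1; D4 DISCHARGE NO DATE).  HONEST
DEPENDENCY: continuum YM on T⁴ ⇐ BetaPertH ∧ nine spine estimates (0/9 proved); BetaPertH ⇐ (D1) ∧ (D4) ∧ CAP+tail; G-an2-4 gates asym, D1 and NE2/3/4.

THE POINT (census sense (α); the COMPARISON column, conjecture (E58′)).  (E64c) states the tower theorem along an explicit decreasing enumeration `a` of the
ages; §1 here supplies the enumeration of an arbitrary finite set `A` (`i ↦ orderEmbOfFin A (#A−1−i)`, strictly decreasing, onto `A`) so that the theorem reads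
like (E63c) `le_of_isotone_excess_tower_ratio_uniform` with the height-dependent condition `3(√2∕2)(n−1) + 4 ≤ 2R(1−√2∕2)^n` REPLACED BY `R = 30`; §2 is the
three-age instance (`30·k₁ ≤ k₂`, `30·k₂ ≤ k₃`; (E63c) §3: `165`).  NOT CLAIMED: ratios below `30`; anything printed.

WHAT IS PROVED ([folklore]; 0 `def`, 0 sorry).  §1 **`le_of_isotone_excess_ages_ratio_thirty`**.  §2 **`le_of_isotone_excess_three_ages_thirty`**.
-/
noncomputable section
open Finset Set

namespace Summit.QuantumFields.BalabanUV.Beta.EriceRemainderEnclosureHistoryAutonomyComparisonTowerSlackEnd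

open Literature.MathematicalPhysics.QuantumFieldTheory.Balaban1983to89
open Literature.MathematicalPhysics.QuantumFieldTheory.Balaban1983to89.T4BetaStationary
open Literature.MathematicalPhysics.QuantumFieldTheory.Balaban1983to89.T4BetaFlowWellPosed
open Summit.QuantumFields.BalabanUV.Beta.EriceRemainderEnclosureHistoryAutonomyComparisonTowerSlack (le_of_isotone_excess_tower_slack)

variable {B' : (ℕ → ℝ) → ℝ} {M' γ b : ℝ} {L : ℕ → ℝ} {K : ℕ} {h h' : ℕ → ℝ} {A : Finset ℕ}

/-! ## §1 The Finset form: enumerate the ages from the oldest down -/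

/-- **EVERY FINITE SET OF AGES WITH PAIRWISE RATIOS `≥ 30` COMPARES AT ANY SIZE, WHATEVER ITS CARDINALITY (Finset form of (E64c)).**  `B(u) = b + Σ_{k<K} L_k·u_k`
on ]0,γ] with `b > 0`, `L ≥ 0` supported on `{0} ∪ A`, `A ⊆ [1, K[` with **`30·k ≤ k′` for `k < k′` in `A`** — `#A`, the sizes `L_k` AND the Markov weight `L_0`
ARBITRARY; `B′` with zeroth moment `M′ ≥ 0`, `B ≤ B′`, ISOTONE excess; `h`, `h′` ANY box solutions from one pin `p ∈ ]0,γ]`.  Then `h′ ≤ h` at EVERY scale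
((E64c) `le_of_isotone_excess_tower_slack` along the decreasing enumeration `i ↦ orderEmbOfFin A (#A−1−i)`).  (E63c) `le_of_isotone_excess_tower_ratio_uniform`
needed `3(√2∕2)(n−1) + 4 ≤ 2R(1−√2∕2)^n`. [folklore] -/
theorem le_of_isotone_excess_ages_ratio_thirty {p : ℝ} (hL : ∀ k, 0 ≤ L k) (hb : 0 < b) (hAK : A ⊆ range K) (hA1 : ∀ k ∈ A, 1 ≤ k)
    (hsupp : ∀ k ∈ range K, k ∉ A → k ≠ 0 → L k = 0) (hsep : ∀ k ∈ A, ∀ k' ∈ A, k < k' → 30 * k ≤ k')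
    (hB' : ∀ u u' : ℕ → ℝ, SeqBox γ u → SeqBox γ u' → ∀ D : ℝ, (∀ j, |u j - u' j| ≤ D) → |B' u - B' u'| ≤ M' * D) (hM' : 0 ≤ M')
    (hexc : ∀ u, SeqBox γ u → (fun u : ℕ → ℝ => b + ∑ k ∈ range K, L k * u k) u ≤ B' u)
    (hDmono : ∀ u v : ℕ → ℝ, SeqBox γ u → SeqBox γ v → (∀ j, u j ≤ v j) →
      B' u - (fun u : ℕ → ℝ => b + ∑ k ∈ range K, L k * u k) u ≤ B' v - (fun u : ℕ → ℝ => b + ∑ k ∈ range K, L k * u k) v)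
    (hp : 0 < p) (hpγ : p ≤ γ) (hh : SeqBox γ h) (hf : MemFlow (fun u : ℕ → ℝ => b + ∑ k ∈ range K, L k * u k) p h)
    (hh' : SeqBox γ h') (hf' : MemFlow B' p h') (j : ℕ) : h' j ≤ h j := by
  classical
  set n := A.card with hn
  set e : Fin n ↪o ℕ := A.orderEmbOfFin hn.symm with he
  -- the decreasing enumeration (junk value 0 beyond n)
  set a : ℕ → ℕ := fun i => if hi : i < n then e ⟨n - 1 - i, by omega⟩ else 0 with ha_def
  have ha_mem : ∀ i < n, a i ∈ A := fun i hi => by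
    simp only [ha_def, dif_pos hi]; exact A.orderEmbOfFin_mem hn.symm _
  have ha1 : ∀ i < n, 1 ≤ a i := fun i hi => hA1 _ (ha_mem i hi)
  have haK : ∀ i < n, a i < K := fun i hi => mem_range.mp (hAK (ha_mem i hi))
  have hsep' : ∀ i, i + 1 < n → 30 * a (i + 1) ≤ a i := by
    intro i hi
    have hi0 : i < n := by omega
    have hlt : a (i + 1) < a i := by
      simp only [ha_def, dif_pos hi, dif_pos hi0]
      exact e.strictMono (Fin.mk_lt_mk.mpr (by omega))
    exact hsep _ (ha_mem _ hi) _ (ha_mem _ hi0) hlt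
  have hsupp' : ∀ k ∈ range K, k ≠ 0 → (∀ i < n, k ≠ a i) → L k = 0 := by
    intro k hk hk0 hne
    refine hsupp k hk (fun hkA => ?_) hk0
    -- k ∈ A is in the range of the enumeration
    have : k ∈ Set.range e := by rw [he, A.range_orderEmbOfFin]; exact hkA
    obtain ⟨m, hm⟩ := this
    have hi : n - 1 - m.val < n := by have := m.2; omega
    refine hne (n - 1 - m.val) hi ?_
    simp only [ha_def, dif_pos hi]
    rw [← hm]
    congr 1
    ext; simp only; have := m.2; omega
  exact le_of_isotone_excess_tower_slack hL hb ha1 haK hsep' hsupp' hB' hM' hexc hDmono hp hpγ hh hf hh' hf' j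

/-! ## §2 Three ages with consecutive ratios `≥ 30` -/

/-- **THREE AFFINE AGES WITH CONSECUTIVE RATIOS `≥ 30`, WITH A MARKOV RIDER, COMPARE AT ANY SIZE.**  `B(u) = b + L_0·u_0 + L₁·u_{k₁} + L₂·u_{k₂} + L₃·u_{k₃}`
on ]0,γ] (`b > 0`; `L ≥ 0` supported on `{0, k₁, k₂, k₃}`, `1 ≤ k₁`, `30·k₁ ≤ k₂`, `30·k₂ ≤ k₃ < K` — ALL FOUR SIZES ARBITRARY); `B′` with zeroth moment
`M′ ≥ 0`, `B ≤ B′`, ISOTONE excess; `h`, `h′` ANY box solutions of `B`, `B′` from one pin `p ∈ ]0,γ]`.  Then `h′ ≤ h` at EVERY scale ((E63c)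
`le_of_isotone_excess_three_ages_uniform`: ratios `165`; (E62b): `260`, no Markov weight). [folklore] -/
theorem le_of_isotone_excess_three_ages_thirty {p : ℝ} {k₁ k₂ k₃ : ℕ} (hL : ∀ k, 0 ≤ L k) (hb : 0 < b) (hk₁ : 1 ≤ k₁) (h12 : 30 * k₁ ≤ k₂)
    (h23 : 30 * k₂ ≤ k₃) (hk₃K : k₃ < K) (hsupp : ∀ k ∈ range K, k ≠ 0 → k ≠ k₁ → k ≠ k₂ → k ≠ k₃ → L k = 0)
    (hB' : ∀ u u' : ℕ → ℝ, SeqBox γ u → SeqBox γ u' → ∀ D : ℝ, (∀ j, |u j - u' j| ≤ D) → |B' u - B' u'| ≤ M' * D) (hM' : 0 ≤ M')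
    (hexc : ∀ u, SeqBox γ u → (fun u : ℕ → ℝ => b + ∑ k ∈ range K, L k * u k) u ≤ B' u)
    (hDmono : ∀ u v : ℕ → ℝ, SeqBox γ u → SeqBox γ v → (∀ j, u j ≤ v j) →
      B' u - (fun u : ℕ → ℝ => b + ∑ k ∈ range K, L k * u k) u ≤ B' v - (fun u : ℕ → ℝ => b + ∑ k ∈ range K, L k * u k) v)
    (hp : 0 < p) (hpγ : p ≤ γ) (hh : SeqBox γ h) (hf : MemFlow (fun u : ℕ → ℝ => b + ∑ k ∈ range K, L k * u k) p h)
    (hh' : SeqBox γ h') (hf' : MemFlow B' p h') (j : ℕ) : h' j ≤ h j := by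
  -- the decreasing enumeration a 0 = k₃, a 1 = k₂, a 2 = k₁
  set a : ℕ → ℕ := fun i => if i = 0 then k₃ else if i = 1 then k₂ else k₁ with ha_def
  have ha0 : a 0 = k₃ := by simp [ha_def]
  have ha1' : a 1 = k₂ := by simp [ha_def]
  have ha2 : a 2 = k₁ := by simp [ha_def]
  refine le_of_isotone_excess_tower_slack (n := 3) (a := a) hL hb ?_ ?_ ?_ ?_ hB' hM' hexc hDmono hp hpγ hh hf hh' hf' j
  · intro i hi
    interval_cases i
    · rw [ha0]; omega
    · rw [ha1']; omega
    · rw [ha2]; exact hk₁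
  · intro i hi
    interval_cases i
    · rw [ha0]; exact hk₃K
    · rw [ha1']; omega
    · rw [ha2]; omega
  · intro i hi
    have hi2 : i < 2 := by omega
    interval_cases i
    · rw [ha0, ha1']; exact h23
    · rw [ha1', ha2]; exact h12
  · intro k hk hk0 hne
    exact hsupp k hk hk0 (by have := hne 2 (by norm_num); rwa [ha2] at this) (by have := hne 1 (by norm_num); rwa [ha1'] at this)
      (by have := hne 0 (by norm_num); rwa [ha0] at this)

end Summit.QuantumFields.BalabanUV.Beta.EriceRemainderEnclosureHistoryAutonomyComparisonTowerSlackEnd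

end
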